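import Literature.Topology.FourManifolds.NeckCapping
import Literature.Topology.FourManifolds.GluingUniqueness
import HarnessLib

/-!
# Uniqueness of the capped side of a neck

Topic `Literature/Topology/FourManifolds`. For a neck `ψ : Sⁿ × ℝ ↪ P` with side
`D : NeckCapData n ψ` (`NeckCapping.lean`), the capped side `D.Capped = D.side ∪_ψ E` is the
gluing of the side and the disc `E` along the polar identification `ψ (θ, t) ∼ t • θ` (`t > 0`)
of the upper half-neck with the punctured disc (`NeckCapData.glueData`). This file records the
relation of that gluing explicitly (`NeckCapData.CapRel`) and proves that **any manifold presented
as an open gluing of the side and the disc along it is diffeomorphic to `D.Capped`**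
(`NeckCapData.nonempty_diffeomorph_of_isOpenGluing`), by the tree's uniqueness of open gluings
(`Literature.Topology.FourManifolds.IsOpenGluing.nonempty_diffeomorph`, `GluingUniqueness.lean`;
Kosinski, *Differential Manifolds*, Ch. VI §1, proof of Thm. (1.1): "the unique structure for
which the projections are diffeomorphisms").

This is the docking port by which a manifold obtained from the side of a neck by attaching a
disc ALONG THE NECK'S OWN PRODUCT STRUCTURE in some other way — e.g. a component of a
hypersurface of `ℝ⁵` after a neck has been replaced by a standard cap continuing the round
cylinder of the neck (Haslhofer–Kleiner's surgery, as used in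
`Literature/Geometry/Riemannian/LowEntropyHypersurfacesFourNeckSurgery.lean`) — is identified with
the canonical capped side: it suffices to exhibit the inclusion of the side and a parametrisation
of the cap region by the disc as open smooth embeddings covering the manifold and overlapping
exactly along `CapRel`. No input from Cerf's `Γ₄ = 0` is involved (the two discs are attached by
the SAME collar, not merely along the same sphere).

Everything here is proved; no definitions of manifolds, no named facts.

## References

* A. Kosinski, *Differential Manifolds* (1993), Ch. VI §1, Thm. (1.1) and its proof. [Kosinski1993]
* R. S. Hamilton, Comm. Anal. Geom. 5 (1997), §1.1 pp. 3–4 ("rounding off the ends"). [Hamilton1997]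
-/

open scoped Manifold ContDiff Topology
open Set Function Metric Module

noncomputable section

namespace Literature.Topology.FourManifolds

namespace NeckCapData

universe u v

variable {E : Type v} [NormedAddCommGroup E] [InnerProductSpace ℝ E] {n : ℕ} [Fact (finrank ℝ E = n + 1)]
  {P : Type u} [TopologicalSpace P] [ChartedSpace E P] {ψ : sphere (0 : E) 1 × ℝ → P}

/-- **The gluing relation of the cap**: the point `a` of the side is identified with the point
`x` of the disc iff `a = ψ (θ, t)` and `x = t • θ` for some `θ ∈ Sⁿ`, `t > 0` (the polar
identification of the upper half-neck with the punctured disc). [cite: Hamilton1997, §1.1 p. 3] -/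
def CapRel (D : NeckCapData n ψ) (a : D.side) (x : E) : Prop :=
  ∃ (θ : sphere (0 : E) 1) (t : ℝ), 0 < t ∧ ψ (θ, t) = a ∧ t • (θ : E) = x

/-- `CapRel` is the graph of the gluing map `D.glue` of the cap. [folklore] -/
theorem capRel_iff (D : NeckCapData n ψ) (a : D.side) (x : E) :
    D.CapRel a x ↔ a ∈ D.glue.source ∧ D.glue a = x := by
  constructor
  · rintro ⟨θ, t, ht, ha, hx⟩
    have hsrc : a ∈ D.glue.source := by
      rw [D.mem_glue_source, D.mem_glueP_source]
      exact ⟨θ, t, ht, ha⟩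
    refine ⟨hsrc, ?_⟩
    rw [D.glue_apply, ← ha, D.glueP_apply_ψ]
    exact hx
  · rintro ⟨hsrc, hx⟩
    obtain ⟨θ, t, ht, ha⟩ := D.mem_glueP_source.1 (D.mem_glue_source.1 hsrc)
    refine ⟨θ, t, ht, ha, ?_⟩
    rw [← hx, D.glue_apply, ← ha, D.glueP_apply_ψ]

/-- **The capped side is an open gluing of the side and the disc along `CapRel`** (with the
structure maps `inl`, `inr`). [cite: Kosinski1993, Ch. VI §1 (1.1)] -/
theorem isOpenGluingWith_capped (D : NeckCapData n ψ) [IsManifold 𝓘(ℝ, E) ∞ P] :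
    IsOpenGluingWith 𝓘(ℝ, E) 𝓘(ℝ, E) 𝓘(ℝ, E) D.CapRel D.glueData.inl D.glueData.inr :=
  D.glueData.isOpenGluingWith fun a x => D.capRel_iff a x

/-- The capped side is an open gluing of the side and the disc along `CapRel`.
[cite: Kosinski1993, Ch. VI §1 (1.1)] -/
theorem isOpenGluing_capped (D : NeckCapData n ψ) [IsManifold 𝓘(ℝ, E) ∞ P] :
    IsOpenGluing 𝓘(ℝ, E) 𝓘(ℝ, E) 𝓘(ℝ, E) (P := D.Capped) D.CapRel :=
  D.glueData.isOpenGluing fun a x => D.capRel_iff a x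

/-- **Uniqueness of the capped side.** Any `C^∞` manifold `X` (modelled on `E`) presented as an
open gluing of the side `D.side` and the disc `E` along the cap relation `CapRel` — i.e. carrying
open smooth embeddings of the side and of the disc which cover `X` and overlap exactly along the
polar identification `ψ (θ, t) ∼ t • θ`, `t > 0` — is diffeomorphic to the canonical capped side
`D.Capped` (Kosinski's uniqueness of the smooth structure on an identification space,
`IsOpenGluing.nonempty_diffeomorph`). In particular a manifold obtained from the side by attaching
a disc along the neck's own product structure in any other way (a standard cap continuing the
round cylinder of the neck, say) is the capped side up to diffeomorphism; no input from Cerf's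
theorem is involved, the discs being attached by the same collar.
[cite: Kosinski1993, Ch. VI §1, proof of Thm (1.1)] [cite: Hamilton1997, §1.1 pp. 3–4] -/
theorem nonempty_diffeomorph_of_isOpenGluing (D : NeckCapData n ψ) [IsManifold 𝓘(ℝ, E) ∞ P]
    {X : Type*} [TopologicalSpace X] [ChartedSpace E X] [IsManifold 𝓘(ℝ, E) ∞ X]
    (hX : IsOpenGluing 𝓘(ℝ, E) 𝓘(ℝ, E) 𝓘(ℝ, E) (P := X) D.CapRel) :
    Nonempty (X ≃ₘ⟮𝓘(ℝ, E), 𝓘(ℝ, E)⟯ D.Capped) :=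
  hX.nonempty_diffeomorph D.isOpenGluing_capped

/-- The same, with the open gluing given by explicit structure maps `jA : D.side → X` (the side)
and `jB : E → X` (the cap). [cite: Kosinski1993, Ch. VI §1, proof of Thm (1.1)] -/
theorem nonempty_diffeomorph_of_isOpenGluingWith (D : NeckCapData n ψ) [IsManifold 𝓘(ℝ, E) ∞ P]
    {X : Type*} [TopologicalSpace X] [ChartedSpace E X] [IsManifold 𝓘(ℝ, E) ∞ X]
    {jA : D.side → X} {jB : E → X}
    (hX : IsOpenGluingWith 𝓘(ℝ, E) 𝓘(ℝ, E) 𝓘(ℝ, E) D.CapRel jA jB) :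
    Nonempty (X ≃ₘ⟮𝓘(ℝ, E), 𝓘(ℝ, E)⟯ D.Capped) :=
  D.nonempty_diffeomorph_of_isOpenGluing hX.isOpenGluing

end NeckCapData

end Literature.Topology.FourManifolds

end
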